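import Summits.HodgeConjecture.HodgeConjecture.Theses.SecondaryPeriods

/-!
# Route `SecondaryPeriods`: the logical position of `AttractorPlanesConiveauOne` (stmt-HodgeConjecture-10377)

`AttractorPlanesConiveauOne` is, verbatim, the crux `LevelOneConiveauThreefolds` (GHC(3,1) for smooth
projective threefolds, stmt-HodgeConjecture-10376) with ONE extra hypothesis
`Module.finrank ℂ (A.hodgePQ 3 3 0) = 1` (`h^{3,0}(Y) = 1`) inserted after the Hodge model `A` and
otherwise the same binders, hypotheses and conclusion. This file records the three formal edges that
follow by pure logic:

* `attractorPlanesConiveauOne_of_levelOneConiveauThreefolds` — the crux implies the support item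
  (drop the `h^{3,0} = 1` hypothesis);
* `coniveauOneFailure_of_not_attractorPlanesConiveauOne` — contrapositive: a threefold with
  `h^{3,0} = 1` carrying a rational level-one sub-Hodge structure of `H³` not supported on a divisor
  IS a witness of the negative-side crux `ConiveauOneFailure = ¬ LevelOneConiveauThreefolds`
  (stmt-HodgeConjecture-3540);
* `attractorPlanesConiveauOne_of_hodgeConjecture` — with Grothendieck's observation
  `HodgeImpliesConiveauOne : HodgeConjecture → LevelOneConiveauThreefolds` (stmt-HodgeConjecture-3541)
  the Hodge conjecture implies the item.

No mathematics beyond the route's own definitions is used; the content of the item itself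
(GHC(3,1) for threefolds of geometric genus one, which contains the Calabi–Yau case) is open.
-/

-- `Summit.HodgeConjecture.HodgeConjecture.Theorems` is the mandated namespace (single-conjunct summit:
-- Sub = Summit), which `linter.dupNamespace` flags on every declaration; the lakefile turns the
-- linter off tree-wide (weak option), restated here so stand-alone elaboration is warning-free too.
set_option linter.dupNamespace false

namespace Summit.HodgeConjecture.HodgeConjecture.Theorems

open Theses.SecondaryPeriods

/-- **The crux implies the support item.** GHC(3,1) for all smooth projective threefolds
(`LevelOneConiveauThreefolds`, stmt-HodgeConjecture-10376) gives it in particular for those with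
`h^{3,0} = 1` (`AttractorPlanesConiveauOne`, stmt-HodgeConjecture-10377): the extra hypothesis
`Module.finrank ℂ (A.hodgePQ 3 3 0) = 1` is simply discarded. [folklore] -/
theorem attractorPlanesConiveauOne_of_levelOneConiveauThreefolds (h : LevelOneConiveauThreefolds) :
    AttractorPlanesConiveauOne :=
  fun _Y hY A _h30 s hs hsub hlev ↦ h hY A s hs hsub hlev

/-- **Contrapositive.** A counterexample to `AttractorPlanesConiveauOne` — a smooth projective threefold
with `h^{3,0} = 1` and a rational level-one sub-Hodge structure of `H³` not supported on a divisor —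
proves the negative-side crux `ConiveauOneFailure = ¬ LevelOneConiveauThreefolds`
(stmt-HodgeConjecture-3540). [folklore] -/
theorem coniveauOneFailure_of_not_attractorPlanesConiveauOne (h : ¬ AttractorPlanesConiveauOne) :
    ConiveauOneFailure :=
  fun hGHC ↦ h (attractorPlanesConiveauOne_of_levelOneConiveauThreefolds hGHC)

/-- **HC implies the item**, through Grothendieck's observation `HodgeImpliesConiveauOne :
HodgeConjecture → LevelOneConiveauThreefolds` (stmt-HodgeConjecture-3541; Grothendieck 1969, p. 301:
HC for the fourfolds `Y × C` gives GHC in level one for `Y`). [folklore] -/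
theorem attractorPlanesConiveauOne_of_hodgeConjecture (hImp : HodgeImpliesConiveauOne)
    (hHC : _root_.HodgeConjecture) : AttractorPlanesConiveauOne :=
  attractorPlanesConiveauOne_of_levelOneConiveauThreefolds (hImp hHC)

end Summit.HodgeConjecture.HodgeConjecture.Theorems
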